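import Summits.ValiantsHypothesis.ValiantsHypothesis.Theorems.LacunarySymmetroidMatrixDescartesCensusExteriorTangentRoots
import Summits.ValiantsHypothesis.ValiantsHypothesis.Theorems.LacunarySymmetroidMatrixDescartesCensusEnvelopeBudgetCard

/-!
# `MatrixDescartes` census — the EXTERIOR-TANGENT LAW, part V: the rows ON A HYPOTHETICAL TWENTY (all supports)

HONEST FRAMING.  Object-search cell `pub-symmetroid`, door-A seat `val-sym-door-p1` (g13); helper beside the OPEN typed statements
`DoorA26 = PosRootLawAt 2 6 19` (stmt-ValiantsHypothesis-19979) and `DoorA34` (19980), asserted nowhere.  The twenty-level packaging of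
`…CensusExteriorTangentRoots.exteriorTangent_matrix`, in the currency of the census line (`Census.not_doorA26_iff`: a counterexample to the door
is ONE symmetric `(2,6)` pencil with `20` distinct positive det-roots): **for every support `d` and every symmetric pencil with `≥ 20` distinct
positive det-roots, the roots are exactly twenty, `r 0 < ⋯ < r 19`, every positive det-root is one of them, and on every gap `(r k, r (k+1))`
that is indefinite (one point of negative determinant) between boundary matrices of the SAME type (`tr F(r k)·tr F(r (k+1)) > 0`) there is an
abscissa `x₀` carrying the exterior-tangent rows** — `det(E₀ − μF₀)·tr²F₀ ≤ det F₀·tr²(E₀ − μF₀)` and `det(E₀ − μF₀) ≤ 0` for every real `μ`,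
`(x₀ f'(x₀))² ≤ 4 det F₀ · det E₀` (entry form), `det F₀ < 0`, `det E₀ ≤ 0` — where `F₀ = Σ_l r… ` is the pencil and `E₀ = Σ_l (d_l x₀^{d_l}) • S_l`
the Euler pencil at `x₀` (`exteriorTangent_rows_of_twenty`).  By the envelope budget (`…CensusEnvelopeBudget`: at most three type flips along
the roots) at least seven of the bounded indefinite gaps of a twenty qualify.  Nothing here bounds `ζ_sym(2,6)`/`ζ_sym(3,4)`, decides
`DoorA26`/`DoorA34`, or bears on `MatrixDescartes` (stmt-ValiantsHypothesis-18050) / `VP ≠ VNP`.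

[folklore] Sorting a finite set of roots (`Finset.orderEmbOfFin`) + the companion theorem.
-/

-- `Summit.ValiantsHypothesis.ValiantsHypothesis.…` repeats a component by the D-0017 layout
-- (single-conjunct summit), which the `dupNamespace` linter flags; the name is mandated.
set_option linter.dupNamespace false

namespace Summit.ValiantsHypothesis.ValiantsHypothesis.Theorems.LacunarySymmetroidMatrixDescartes.Census

open Set Finset Polynomial
open scoped BigOperators Topology

/-- **EXTERIOR-TANGENT ROWS OF A HYPOTHETICAL TWENTY** (symmetric letters, ANY support). [folklore] -/
theorem exteriorTangent_rows_of_twenty (d : Fin 6 → ℕ) (S : Fin 6 → Matrix (Fin 2) (Fin 2) ℝ) (hS : ∀ l, (S l).IsSymm)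
    (h20 : 20 ≤ ((Matrix.det (∑ l, ((X : ℝ[X]) ^ d l) • (S l).map C)).roots.toFinset.filter (fun t => 0 < t)).card) :
    ∃ r : Fin 20 → ℝ, StrictMono r ∧ (∀ k, 0 < r k) ∧ (∀ k, (∑ l, r k ^ d l • S l).det = 0) ∧
      (∀ x, 0 < x → (∑ l, x ^ d l • S l).det = 0 → ∃ k, x = r k) ∧
      ∀ k : Fin 19, ∀ m ∈ Ioo (r k.castSucc) (r k.succ), (∑ l, m ^ d l • S l).det < 0 →
        0 < (∑ l, r k.castSucc ^ d l • S l).trace * (∑ l, r k.succ ^ d l • S l).trace →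
        ∃ x₀ ∈ Ioo (r k.castSucc) (r k.succ),
          (∀ μ : ℝ, ((∑ l, ((d l : ℝ) * x₀ ^ d l) • S l) - μ • (∑ l, x₀ ^ d l • S l)).det
                * ((∑ l, x₀ ^ d l • S l).trace) ^ 2
              ≤ (∑ l, x₀ ^ d l • S l).det
                * (((∑ l, ((d l : ℝ) * x₀ ^ d l) • S l) - μ • (∑ l, x₀ ^ d l • S l)).trace) ^ 2) ∧
          (∀ μ : ℝ, ((∑ l, ((d l : ℝ) * x₀ ^ d l) • S l) - μ • (∑ l, x₀ ^ d l • S l)).det ≤ 0) ∧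
          ((∑ l, x₀ ^ d l • S l) 0 0 * (∑ l, ((d l : ℝ) * x₀ ^ d l) • S l) 1 1
              + (∑ l, x₀ ^ d l • S l) 1 1 * (∑ l, ((d l : ℝ) * x₀ ^ d l) • S l) 0 0
              - 2 * (∑ l, x₀ ^ d l • S l) 0 1 * (∑ l, ((d l : ℝ) * x₀ ^ d l) • S l) 0 1) ^ 2
            ≤ 4 * (∑ l, x₀ ^ d l • S l).det * (∑ l, ((d l : ℝ) * x₀ ^ d l) • S l).det ∧
          (∑ l, x₀ ^ d l • S l).det < 0 ∧ (∑ l, ((d l : ℝ) * x₀ ^ d l) • S l).det ≤ 0 := by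
  classical
  set p := Matrix.det (∑ l, ((X : ℝ[X]) ^ d l) • (S l).map C) with hp
  set Z := p.roots.toFinset.filter (fun t => 0 < t) with hZ
  have hcard : Z.card = 20 := card_posRoots_eq_twenty_of_le d S h20
  have hp0 : p ≠ 0 := by
    intro h0
    have : Z.card = 0 := by rw [hZ, h0, Polynomial.roots_zero]; simp
    omega
  let e := Z.orderEmbOfFin hcard
  have hmem : ∀ k, e k ∈ Z := fun k => Finset.orderEmbOfFin_mem Z hcard k
  have hpev : ∀ x, p.eval x = (∑ l, x ^ d l • S l).det := fun x => by
    rw [hp]; exact SymmetroidDescartes.eval_det_pencil S d x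
  have hroot : ∀ k, (∑ l, e k ^ d l • S l).det = 0 := by
    intro k
    have hk := hmem k
    rw [hZ, Finset.mem_filter, Multiset.mem_toFinset, Polynomial.mem_roots hp0] at hk
    rw [← hpev]; exact hk.1
  have hpos : ∀ k, 0 < e k := fun k => by
    have hk := hmem k; rw [hZ, Finset.mem_filter] at hk; exact hk.2
  have hall : ∀ x, 0 < x → (∑ l, x ^ d l • S l).det = 0 → ∃ k, x = e k := by
    intro x hx hdx
    have hxZ : x ∈ Z := by
      rw [hZ, Finset.mem_filter, Multiset.mem_toFinset, Polynomial.mem_roots hp0]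
      exact ⟨by rw [Polynomial.IsRoot, hpev]; exact hdx, hx⟩
    have hrange : x ∈ Set.range e := by
      rw [Finset.range_orderEmbOfFin]; exact hxZ
    obtain ⟨k, hk⟩ := hrange
    exact ⟨k, hk.symm⟩
  refine ⟨e, e.strictMono, hpos, hroot, hall, ?_⟩
  intro k m hm hdm hT
  -- no det-root strictly between two consecutive sorted roots
  have hnz : ∀ x ∈ Ioo (e k.castSucc) (e k.succ), (∑ l, x ^ d l • S l).det ≠ 0 := by
    intro x hx h0
    obtain ⟨j, rfl⟩ := hall x (lt_trans (hpos _) hx.1) h0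
    have h1 : k.castSucc < j := e.strictMono.lt_iff_lt.mp hx.1
    have h2 : j < k.succ := e.strictMono.lt_iff_lt.mp hx.2
    rw [Fin.lt_def] at h1 h2
    rw [Fin.val_castSucc] at h1
    rw [Fin.val_succ] at h2
    omega
  exact exteriorTangent_matrix d S hS (hpos _) (e.strictMono (Fin.castSucc_lt_succ (i := k))) (hroot _) (hroot _) hnz hm hdm hT

end Summit.ValiantsHypothesis.ValiantsHypothesis.Theorems.LacunarySymmetroidMatrixDescartes.Census
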